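import Literature.Analysis.FluidPDE.NavierStokesConcentrationGlue
import HarnessLib

/-!
# Cheskidov–Luo 2022, Prop. 3.1 (concentrating the stress error) from the corrector fact

Final file of the proof of `Torus.CheskidovLuo2022Concentration` (Prop. 3.1 of A. Cheskidov,
X. Luo, *Sharp nonuniqueness for the Navier–Stokes equations*, Invent. Math. 229 (2022) =
arXiv:2009.06596, file `NavierStokesReynoldsSteps`) from the named fact
`Torus.CheskidovLuo2022Corrector` (§3.1 + Prop. 3.2, file `NavierStokesConcentrationCorrector`):

* `Torus.CheskidovLuo2022Concentration_of_corrector :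
    CheskidovLuo2022Corrector → CheskidovLuo2022Concentration` (PROVED).

With it, the trust base of Prop. 3.1 — and, through the proved assembly
`Torus.CheskidovLuo2022MainIteration_of_steps`, of half of Prop. 2.2 — is reduced to the single
local well-posedness statement `CheskidovLuo2022Corrector`; discharging that fact discharges
`CheskidovLuo2022Concentration` (`theorem …_holds := CheskidovLuo2022Concentration_of_corrector
CheskidovLuo2022Corrector_holds`).

## The proof (CL22, §§3.2–3.3; see the docstring of `Concentration.concentration_of_corrector`)

Parameters (`Concentration.scale`, `Concentration.exists_subdivision`): `θ = T/n`,
`τ = T n^{-1/ε}` (so `(T/τ)^ε = n` exactly, matching `Torus.IsWellPrepared`), `n` large.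
Correctors from the fact where `R ≢ 0`, zero correctors where `R ≡ 0` (§3.3), glued by
`NavierStokesConcentrationGlue`. Two points where the printed argument is completed:
(i) the index set `E` of §3.3 must consist of the interior nodes `tⱼ` with `R ≢ 0` on
`[tⱼ₋₁, tⱼ₊₁]` (not only `vⱼ ≢ 0`), since the falling cut-off `χⱼ₋₁` carries stress just
before `tⱼ`; (ii) the mean of `|vᵢ|²/d` is subtracted from the pressure (normalisation
`∫ p = 0` of the library's solution notion). The antidivergence `ℛ` is replaced throughout by
the abstract antidivergence `(Aᵢ, πᵢ)` provided by the corrector fact.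

## References

* A. Cheskidov, X. Luo, *Sharp nonuniqueness for the Navier–Stokes equations*, Invent. Math. 229
  (2022), 987–1054; arXiv:2009.06596: Prop. 3.1, §3.1, Prop. 3.2, §3.2, Prop. 3.3, §3.3.
  [`CheskidovLuo2022`]
-/

open MeasureTheory Set Filter Topology
open scoped InnerProductSpace ContDiff ENNReal NNReal

noncomputable section

namespace Literature.Analysis.FluidPDE

namespace Torus

section Assembly

namespace Concentration

open FunctionSpaces.Torus

variable {d : Type*} [Fintype d] [DecidableEq d]

/-! ## Choice of the parameters (CL22, end of §3: "`τ > 0` sufficiently small") -/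

section Parameters

omit [Fintype d] [DecidableEq d]

/-- The scale attached to a subdivision into `n` intervals: `τ = T n^{-1/ε}`, so that the
number of intervals is exactly `(T/τ)^ε = n` (CL22, §3.1: `tᵢ = iτ^ε`, i.e. `n = τ^{-ε}` for
`T = 1`). [cite: CheskidovLuo2022, §3.1] -/
def scale (T ε : ℝ) (n : ℕ) : ℝ := T / (n : ℝ) ^ (1 / ε)

/-- The scale is positive. [folklore] -/
theorem scale_pos {T ε : ℝ} (hT : 0 < T) {n : ℕ} (hn : 0 < n) : 0 < scale T ε n :=
  div_pos hT (Real.rpow_pos_of_pos (by exact_mod_cast hn) _)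

/-- `(T/τ)^ε = n` for `τ = T n^{-1/ε}`. [folklore] -/
theorem div_scale_rpow {T ε : ℝ} (hT : 0 < T) (hε : 0 < ε) (n : ℕ) :
    (T / scale T ε n) ^ ε = n := by
  unfold scale
  rw [div_div_cancel₀ hT.ne', ← Real.rpow_mul (Nat.cast_nonneg n), one_div, inv_mul_cancel₀ hε.ne',
    Real.rpow_one]

/-- `n τ = T n^{-(1/ε - 1)}` for `τ = T n^{-1/ε}` and `n ≥ 1`. [folklore] -/
theorem natCast_mul_scale {T ε : ℝ} {n : ℕ} (hn : 0 < n) :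
    (n : ℝ) * scale T ε n = T * (n : ℝ) ^ (-(1 / ε - 1)) := by
  unfold scale
  have hx : (0 : ℝ) < n := by exact_mod_cast hn
  rw [show -(1 / ε - 1) = 1 - 1 / ε by ring, Real.rpow_sub hx, Real.rpow_one]
  field_simp

/-- `n τₙ → 0` for `τₙ = T n^{-1/ε}`, `0 < ε < 1`. [folklore] -/
theorem tendsto_natCast_mul_scale {T ε : ℝ} (hε : 0 < ε) (hε1 : ε < 1) :
    Tendsto (fun n : ℕ => (n : ℝ) * scale T ε n) atTop (𝓝 0) := by
  have hy : 0 < 1 / ε - 1 := by linarith [one_lt_one_div hε hε1]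
  have h1 : Tendsto (fun n : ℕ => T * (n : ℝ) ^ (-(1 / ε - 1))) atTop (𝓝 0) := by
    have := ((tendsto_rpow_neg_atTop hy).comp tendsto_natCast_atTop_atTop).const_mul T
    simpa using this
  refine h1.congr' ?_
  filter_upwards [eventually_gt_atTop 0] with n hn
  exact (natCast_mul_scale hn).symm

/-- **Choice of the subdivision.** Given the data of the concentration step, there is a
subdivision `n ≥ n₀` of `[0, T]` such that, with `θ = T/n` and `τ = T n^{-1/ε}`: `3τ ≤ θ`,
`2θ ≤ τ₀`, and `(M + 2)·2nτ ≤ N` (CL22, end of the proof of Prop. 3.3 and §3.3: "`τ > 0`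
sufficiently small", "`τ^ε` sufficiently smaller than `τ̃`"). [cite: CheskidovLuo2022, Prop. 3.3 (proof)] -/
theorem exists_subdivision {T ε τ₀ N : ℝ} (M : ℝ) (hT : 0 < T) (hε : 0 < ε) (hε1 : ε < 1)
    (hτ₀ : 0 < τ₀) (hN : 0 < N) (n₀ : ℕ) :
    ∃ n : ℕ, n₀ ≤ n ∧ 0 < n ∧ 3 * scale T ε n ≤ T / n ∧ 2 * (T / n) ≤ τ₀ ∧
      (M + 2) * (2 * (n * scale T ε n)) ≤ N := by
  have hb := tendsto_natCast_mul_scale (T := T) hε hε1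
  have ha : Tendsto (fun n : ℕ => 2 * (T / n)) atTop (𝓝 0) := by
    simpa using (tendsto_const_div_atTop_nhds_zero_nat T).const_mul 2
  have e0 : ∀ᶠ n : ℕ in atTop, n₀ ≤ n := eventually_ge_atTop n₀
  have e0' : ∀ᶠ n : ℕ in atTop, 1 ≤ n := eventually_ge_atTop 1
  have e1 : ∀ᶠ n : ℕ in atTop, 3 * ((n : ℝ) * scale T ε n) ≤ T := by
    have : Tendsto (fun n : ℕ => 3 * ((n : ℝ) * scale T ε n)) atTop (𝓝 0) := by
      simpa using hb.const_mul 3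
    exact this.eventually_le_const hT
  have e2 : ∀ᶠ n : ℕ in atTop, 2 * (T / n) ≤ τ₀ := ha.eventually_le_const hτ₀
  have e3 : ∀ᶠ n : ℕ in atTop, (M + 2) * (2 * ((n : ℝ) * scale T ε n)) ≤ N := by
    have : Tendsto (fun n : ℕ => (M + 2) * (2 * ((n : ℝ) * scale T ε n))) atTop (𝓝 0) := by
      simpa using (hb.const_mul 2).const_mul (M + 2)
    exact this.eventually_le_const hN
  obtain ⟨n, hn₀, hn1, hn2, hn3, hn4⟩ := (e0.and (e0'.and (e1.and (e2.and e3)))).exists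
  have hn : 0 < n := hn1
  refine ⟨n, hn₀, hn, ?_, hn3, hn4⟩
  have hx : (0 : ℝ) < n := by exact_mod_cast hn
  rw [le_div_iff₀ hx]
  linarith

end Parameters

/-! ## Proposition 3.1 from the corrector fact -/

section Main

/-- **Cheskidov–Luo 2022, Prop. 3.1 (concentrating the stress error) from the local correctors
(§3.1 + Prop. 3.2).** The gluing-and-bookkeeping half of the proof of Prop. 3.1, PROVED: given
the named fact `Torus.CheskidovLuo2022Corrector` (existence of the correctors `vᵢ` of (3.2)
with their antidivergence bound, Prop. 3.2), the rendering `Torus.CheskidovLuo2022Concentration`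
of Prop. 3.1 follows, with the constant `C(r, ε) = 4 M_S C_r + 2` (`M_S` the derivative bound of
the smooth transition, `C_r` the constant of Prop. 3.2). Proof (CL22, §§3.2–3.3, with the gap in
§3.3 closed): if `‖R‖_{L¹L^r} = 0` the stress vanishes identically and the input itself, with
`I = ∅`, is the output. Otherwise choose the corrector size
`δ' = min(δ, δ₀, 1, ‖R‖/(4M_SC_uT + 1))`, the subdivision `n` of `exists_subdivision`
(`θ = T/n`, `τ = Tn^{-1/ε}`: `3τ ≤ θ`, `2θ ≤ τ₀`, `(M_R + 2)2nτ ≤ ‖R‖`), the correctors of the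
fact on the grid intervals where `R ≢ 0` and the ZERO corrector where `R ≡ 0` (§3.3), and glue
(`glueVel`, `gluePres`, `glueStress`; `IsGlueData.isNSReynoldsOn`). The set is
`I = ⋃_{j ∈ E} [tⱼ - 5τ/2, tⱼ + 5τ/2]` with `E` the interior nodes `tⱼ` such that `R ≢ 0` on
`[tⱼ₋₁, tⱼ₊₁]` (the paper's `E = {i : vᵢ ≢ 0}` misses the nodes `tᵢ` with `vᵢ₋₁ ≢ 0 ≡ vᵢ`, where
`χᵢ₋₁'ℛvᵢ₋₁ ≠ 0`; with the corrected `E` the printed argument goes through verbatim):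
`card E < n = (T/τ)^ε`; `0, T ∉ I` as `5τ/2 < θ`; `I ⊆ Ĩ` and `Supp_t w̄ ⊆ Ĩ` by the
well-preparedness of the input and `θ + 5τ/2 ≤ τ₀`; if `dist(t, Iᶜ) ≤ 3τ/2` then `|t - tⱼ| ≥ τ`
for all `j ∈ E`, so at `t` either `χᵢ = 1`, `χᵢ' = 0` (plateau) or `t` is `τ`-close to an
interior node off `E`, around which `R ≡ 0` and the corrector is zero — in both cases
`R̄(t) = 0`; the `L¹L^r` bound is `IsGlueData.eLqLpNorm_glueStress_le` with the two small terms
absorbed by the choice of `n` and `δ'`. [cite: CheskidovLuo2022, Prop. 3.1, §§3.2–3.3] -/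
theorem concentration_of_corrector (hcorr : CheskidovLuo2022Corrector (d := d)) :
    CheskidovLuo2022Concentration (d := d) := by
  classical
  intro hd T hT ε hε hε1 r hr
  obtain ⟨C, hC, hmain⟩ := hcorr hd r hr
  set M : ℝ := cutoffDerivBound with hM_def
  have hM1 : 1 ≤ M := one_le_cutoffDerivBound
  have hM0 : 0 ≤ M := zero_le_one.trans hM1
  refine ⟨4 * M * C + 2, by positivity, ?_⟩
  intro δ hδ u P R I₀ τ₀ hsol hmean hwp
  have hr1 : (1 : ℝ≥0∞) ≤ ENNReal.ofReal r := ENNReal.one_le_ofReal.2 hr.le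
  have hd0 : 0 < Fintype.card d := lt_of_lt_of_le two_pos hd
  set N : ℝ≥0∞ := eLqLpNorm 1 (ENNReal.ofReal r) R (Ioo 0 T) with hN
  have hNtop : N < ⊤ := hsol.smooth_stress.eLqLpNorm_lt_top le_rfl _
  rcases eq_or_ne N 0 with hN0 | hN0
  · -- `R ≡ 0`: the identity step with `I = ∅`, `τ = τ₀ / 4`
    have hR0 : ∀ t ∈ Icc 0 T, ∀ x, R t x = 0 :=
      eq_zero_of_eLqLpNorm_eq_zero hsol.smooth_stress hT one_ne_zero hr1 hN0
    refine ⟨u, P, R, ∅, τ₀ / 4, hsol, hmean, isWellPrepared_empty hT.le (by linarith [hwp.pos]) hR0,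
      empty_subset _, fun h => h, fun h => h, by linarith [hwp.pos], fun t ht _ x => hR0 t ht x, ?_,
      fun t _ _ => rfl, rfl, fun t _ x => by simpa using hδ.le⟩
    exact hN0.le.trans bot_le
  -- `N > 0`: correctors, subdivision, gluing
  have hNpos : 0 < N.toReal := ENNReal.toReal_pos hN0 hNtop.ne
  obtain ⟨Cu, δ₀, hCu, hδ₀, hfam⟩ := hmain T hT u P R hsol
  obtain ⟨MR, hMR⟩ := hsol.smooth_stress.exists_norm_le_of_isCompact isCompact_Icc subset_rfl
  have hMR0 : 0 ≤ MR := (norm_nonneg _).trans (hMR 0 ⟨le_rfl, hT.le⟩ 0)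
  -- the size of the correctors
  set δ' : ℝ := min δ (min δ₀ (min 1 (N.toReal / (4 * M * Cu * T + 1)))) with hδ'
  have hden : 0 < 4 * M * Cu * T + 1 := by positivity
  have hδ'pos : 0 < δ' := lt_min hδ (lt_min hδ₀ (lt_min one_pos (div_pos hNpos hden)))
  have hδ'δ : δ' ≤ δ := min_le_left _ _
  have hδ'δ₀ : δ' ≤ δ₀ := (min_le_right _ _).trans (min_le_left _ _)
  have hδ'1 : δ' ≤ 1 := ((min_le_right _ _).trans (min_le_right _ _)).trans (min_le_left _ _)
  have hδ'N : 4 * M * Cu * δ' * T ≤ N.toReal := by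
    have h1 : δ' ≤ N.toReal / (4 * M * Cu * T + 1) :=
      ((min_le_right _ _).trans (min_le_right _ _)).trans (min_le_right _ _)
    rw [le_div_iff₀ hden] at h1
    nlinarith [hδ'pos.le, hM0, hCu, hT.le]
  obtain ⟨n₀, hn₀, hfam'⟩ := hfam δ' hδ'pos hδ'δ₀
  -- the subdivision
  obtain ⟨n, hn₀n, hn, h3τ, h2θ, hest⟩ := exists_subdivision MR hT hε hε1 hwp.pos hNpos n₀
  set θ : ℝ := T / n with hθ
  set τ : ℝ := scale T ε n with hτ_def
  have hτ : 0 < τ := scale_pos hT hn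
  have hθpos : 0 < θ := div_pos hT (by exact_mod_cast hn)
  have hnR : (0 : ℝ) < n := by exact_mod_cast hn
  have hτθ : 5 * τ / 2 < θ := by linarith
  have hττ₀ : τ < τ₀ / 2 := by linarith
  have hθτ₀ : θ + 5 * τ / 2 ≤ τ₀ := by linarith
  -- the correctors: the fact's ones where `R ≢ 0`, zero where `R ≡ 0`
  let Z : ℕ → Prop := fun i => ∀ t ∈ Icc (node T n i) (node T n (i + 1)), ∀ x, R t x = 0
  have hnode : ∀ i : ℕ, node T n (i + 1) = ((i : ℝ) + 1) * (T / n) := fun i => by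
    unfold node; push_cast; ring
  have hex : ∀ i : ℕ, ∃ c : (ℝ → UnitAddTorus d → EuclideanSpace ℝ d) × (ℝ → UnitAddTorus d → ℝ) ×
      (ℝ → UnitAddTorus d → d → EuclideanSpace ℝ d) × (ℝ → UnitAddTorus d → ℝ),
      (i < n → IsCorrector u R r C (Cu * δ' * (T / n)) δ' (node T n i) (node T n (i + 1))
        c.1 c.2.1 c.2.2.1 c.2.2.2) ∧
      (Z i → c = (fun _ _ => 0, fun _ _ => 0, fun _ _ _ => 0, fun _ _ => 0)) := by
    intro i
    by_cases hz : Z i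
    · exact ⟨(fun _ _ => 0, fun _ _ => 0, fun _ _ _ => 0, fun _ _ => 0),
        fun _ => IsCorrector.zero hδ'pos.le hz, fun _ => rfl⟩
    · by_cases hi : i < n
      · obtain ⟨v, q, A, π, hcor⟩ := hfam' n hn₀n i hi
        refine ⟨(v, q, A, π), fun _ => ?_, fun hz' => absurd hz' hz⟩
        rw [hnode i]; exact hcor
      · exact ⟨(fun _ _ => 0, fun _ _ => 0, fun _ _ _ => 0, fun _ _ => 0),
          fun hi' => absurd hi' hi, fun _ => rfl⟩
  choose c hc hcz using hex
  set v : ℕ → ℝ → UnitAddTorus d → EuclideanSpace ℝ d := fun i => (c i).1 with hv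
  set q : ℕ → ℝ → UnitAddTorus d → ℝ := fun i => (c i).2.1 with hq
  set A : ℕ → ℝ → UnitAddTorus d → d → EuclideanSpace ℝ d := fun i => (c i).2.2.1 with hA
  set π : ℕ → ℝ → UnitAddTorus d → ℝ := fun i => (c i).2.2.2 with hπ
  have hzero : ∀ i, Z i → v i = (fun _ _ => 0) ∧ A i = (fun _ _ _ => 0) := fun i hz => by
    have := hcz i hz
    simp only [hv, hA, this, and_self]
  have hglue : IsGlueData T n τ r C (Cu * δ' * (T / n)) δ' u P R v q A π :=
    { hT := hT, hn := hn, hτ := hτ, hτn := by linarith, hd := hd0, nsr := hsol, mean := hmean,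
      cor := fun i hi => hc i hi }
  -- the set `I`
  let Z2 : ℕ → Prop := fun j => ∀ t ∈ Icc (node T n (j - 1)) (node T n (j + 1)), ∀ x, R t x = 0
  set E : Finset ℕ := (Finset.Ico 1 n).filter fun j => ¬Z2 j with hE
  set s : Finset ℝ := E.image fun j => node T n j - 5 * τ / 2 with hs
  set I : Set ℝ := ⋃ a ∈ s, Icc a (a + 5 * τ) with hI
  have hEmem : ∀ {j}, j ∈ E → 1 ≤ j ∧ j < n ∧ ¬Z2 j := fun hj => by
    rw [hE, Finset.mem_filter, Finset.mem_Ico] at hj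
    exact ⟨hj.1.1, hj.1.2, hj.2⟩
  have hImem : ∀ y, y ∈ I ↔ ∃ j ∈ E, node T n j - 5 * τ / 2 ≤ y ∧ y ≤ node T n j + 5 * τ / 2 := by
    intro y
    rw [hI, hs, Finset.set_biUnion_finset_image]
    simp only [mem_iUnion, mem_Icc, exists_prop]
    constructor
    · rintro ⟨j, hj, h1, h2⟩; exact ⟨j, hj, h1, by linarith⟩
    · rintro ⟨j, hj, h1, h2⟩; exact ⟨j, hj, h1, by linarith⟩
  -- nodes of `E` and their neighbours lie in `[0, T]`
  have hnode0 : ∀ i : ℕ, 0 ≤ node T n i := fun i => by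
    have := node_mono hT.le n (Nat.zero_le i); rwa [node_zero] at this
  have hnodeT : ∀ {i : ℕ}, i ≤ n → node T n i ≤ T := fun hi => by
    have := node_mono hT.le n hi; rwa [node_self T hn.ne'] at this
  have hnode_pred : ∀ {j : ℕ}, 1 ≤ j → node T n (j - 1) = node T n j - θ := fun {j} hj => by
    have := node_succ T n (j - 1)
    rw [Nat.sub_add_cancel hj] at this
    linarith
  -- points of `I` are positive and less than `T`
  have hIpos : ∀ y ∈ I, 0 < y ∧ y < T := by
    intro y hy
    obtain ⟨j, hj, h1, h2⟩ := (hImem y).1 hy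
    obtain ⟨hj1, hjn, -⟩ := hEmem hj
    have hlo : θ ≤ node T n j := by
      have := node_mono hT.le n hj1
      simp only [node, Nat.cast_one, one_mul] at this ⊢
      exact this
    have hhi : node T n j ≤ T - θ := by
      have h' := node_mono hT.le n (Nat.le_sub_one_of_lt hjn)
      have h'' : node T n (n - 1) = T - θ := by
        rw [hnode_pred hn, node_self T hn.ne']
      linarith
    constructor <;> linarith
  -- where `R ≢ 0` near a node of `E`, everything `θ + 5τ/2`-close lies in `I₀`
  have hI₀_of_ne : ∀ {S y : ℝ}, S ∈ Icc 0 T → (∃ x, R S x ≠ 0) → dist S y ≤ τ₀ → y ∈ I₀ := by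
    intro S y hS hx hSy
    by_contra hy
    obtain ⟨x, hx⟩ := hx
    exact hx (hwp.stress_eq_zero_of_dist_le hS hy hSy x)
  -- (4) `I ⊆ I₀`
  have hII₀ : I ⊆ I₀ := by
    intro y hy
    obtain ⟨j, hj, h1, h2⟩ := (hImem y).1 hy
    obtain ⟨hj1, hjn, hZ2⟩ := hEmem hj
    simp only [Z2, not_forall] at hZ2
    obtain ⟨S, hS, x, hx⟩ := hZ2
    have hS' : S ∈ Icc 0 T := ⟨(hnode0 _).trans hS.1, hS.2.trans (hnodeT (Nat.succ_le_of_lt hjn))⟩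
    refine hI₀_of_ne hS' ⟨x, hx⟩ ?_
    rw [Real.dist_eq]
    have hp := hnode_pred hj1
    have hsucc := node_succ T n j
    rw [abs_le]; constructor <;> linarith [hS.1, hS.2]
  -- the key to the vanishing: `dist(t, Iᶜ) ≤ 3τ/2` keeps `t` at distance `≥ τ` from `E`-nodes
  have hfar : ∀ {t : ℝ}, Metric.infDist t Iᶜ ≤ 3 * τ / 2 → ∀ j ∈ E, τ ≤ |t - node T n j| := by
    intro t hdist j hj
    by_contra hlt
    rw [not_le] at hlt
    have hne : (Iᶜ : Set ℝ).Nonempty := ⟨-1, fun h => by linarith [(hIpos _ h).1]⟩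
    obtain ⟨y, hyI, hy⟩ := (Metric.infDist_lt_iff hne).1
      (lt_of_le_of_lt hdist (by linarith : 3 * τ / 2 < 3 * τ / 2 + (τ - |t - node T n j|)))
    rw [Real.dist_eq] at hy
    have hyj : |y - node T n j| < 5 * τ / 2 := by
      calc |y - node T n j| = |(y - t) + (t - node T n j)| := by ring_nf
        _ ≤ |y - t| + |t - node T n j| := abs_add_le _ _
        _ = |t - y| + |t - node T n j| := by rw [abs_sub_comm y t]
        _ < 5 * τ / 2 := by linarith
    rw [abs_lt] at hyj
    exact hyI ((hImem y).2 ⟨j, hj, by linarith [hyj.1], by linarith [hyj.2]⟩)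
  -- (8) the vanishing of the concentrated stress
  have hvanish : ∀ t ∈ Icc 0 T, Metric.infDist t Iᶜ ≤ 3 * τ / 2 → ∀ x, glueStress T n τ R v A t x = 0 := by
    intro t ht hdist x
    obtain ⟨i, hi, hti⟩ := exists_mem_Icc_node hT hn ht
    have hfar' := hfar hdist
    funext j'
    rw [hglue.glueStress_apply hi hti x j']
    by_cases hpl : (i = 0 ∨ node T n i + τ ≤ t) ∧ (i + 1 = n ∨ t ≤ node T n (i + 1) - τ)
    · -- plateau: `χᵢ = 1`, `χᵢ' = 0`
      have c1 : cutoff T n τ i t = 1 :=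
        cutoff_eq_one hτ (hpl.1.imp id fun h => by linarith) (hpl.2.imp id fun h => by linarith)
      have c0 : deriv (cutoff T n τ i) t = 0 :=
        deriv_cutoff_eq_zero hτ (hpl.1.imp id fun h => Or.inr (by linarith))
          (hpl.2.imp id fun h => Or.inl (by linarith))
      simp [c1, c0]
    · -- `τ`-close to an interior node, which is then off `E`: zero corrector, `R = 0`
      have hZi : Z i := by
        rcases not_and_or.1 hpl with h1 | h2
        · rw [not_or, not_le] at h1
          have hi1 : 1 ≤ i := Nat.one_le_iff_ne_zero.2 h1.1
          have hiE : i ∉ E := fun hiE => by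
            have := hfar' i hiE
            rw [abs_of_nonneg (by linarith [hti.1])] at this
            linarith [h1.2]
          have hZ2 : Z2 i := by
            by_contra hz
            exact hiE (by rw [hE, Finset.mem_filter, Finset.mem_Ico]; exact ⟨⟨hi1, hi⟩, hz⟩)
          intro s hs y
          refine hZ2 s ⟨?_, hs.2⟩ y
          rw [hnode_pred hi1]; linarith [hs.1]
        · rw [not_or, not_le] at h2
          have hi1 : 1 ≤ i + 1 := Nat.succ_le_succ (Nat.zero_le _)
          have hin : i + 1 < n := lt_of_le_of_ne (Nat.succ_le_of_lt hi) h2.1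
          have hiE : i + 1 ∉ E := fun hiE => by
            have := hfar' (i + 1) hiE
            rw [abs_of_nonpos (by linarith [hti.2])] at this
            linarith [h2.2]
          have hZ2 : Z2 (i + 1) := by
            by_contra hz
            exact hiE (by rw [hE, Finset.mem_filter, Finset.mem_Ico]; exact ⟨⟨hi1, hin⟩, hz⟩)
          intro s hs y
          refine hZ2 s ⟨by simpa using hs.1, ?_⟩ y
          have := node_succ T n (i + 1)
          linarith [hs.2]
      obtain ⟨hv0, hA0⟩ := hzero i hZi
      have hR0 : R t x j' = 0 := by rw [hZi t hti x]; rfl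
      simp [hR0, hv0, hA0, tracelessSq]
  -- the output
  refine ⟨glueVel T n τ u v, gluePres T n τ P v q π, glueStress T n τ R v A, I, τ,
    hglue.isNSReynoldsOn, fun t ht => hglue.hasZeroMean_glueVel ht, ?_, hII₀, ?_, ?_, hττ₀,
    hvanish, ?_, ?_, hglue.glueVel_zero, fun t ht x => (hglue.norm_glueVel_sub_le ht x).trans hδ'δ⟩
  · -- (3) well-preparedness
    refine ⟨hτ, ⟨s, ?_, rfl⟩, fun t ht hdist x => hvanish t ht (hdist.trans (by linarith)) x⟩
    rw [div_scale_rpow hT hε n]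
    calc (s.card : ℝ) ≤ E.card := by exact_mod_cast Finset.card_image_le
      _ ≤ (Finset.Ico 1 n).card := by exact_mod_cast Finset.card_filter_le _ _
      _ ≤ n := by rw [Nat.card_Ico]; exact_mod_cast Nat.sub_le n 1
  · -- (5) `0 ∉ I`
    exact fun h0 => lt_irrefl _ (hIpos 0 h0).1
  · -- (6) `T ∉ I`
    exact fun hT' => lt_irrefl _ (hIpos T hT').2
  · -- (9) the `L¹L^r` estimate
    have hK : 0 ≤ Cu * δ' * (T / n) := by positivity
    have hE1 := hglue.eLqLpNorm_glueStress_le hr.le hδ'pos.le hC.le hK hMR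
    have hnK : (n : ℝ) * (Cu * δ' * (T / n)) = Cu * δ' * T := by field_simp
    rw [hnK] at hE1
    refine hE1.trans ?_
    have hNeq : ENNReal.ofReal N.toReal = N := ENNReal.ofReal_toReal hNtop.ne
    have h1 : ENNReal.ofReal ((MR + 2 * δ' ^ 2) * (2 * n * τ)) ≤ N := by
      rw [← hNeq]
      refine ENNReal.ofReal_le_ofReal ?_
      have hδ'2 : δ' ^ 2 ≤ 1 := by nlinarith
      have hnτ : 0 ≤ (n : ℝ) * τ := by positivity
      calc (MR + 2 * δ' ^ 2) * (2 * n * τ) ≤ (MR + 2) * (2 * n * τ) := by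
            apply mul_le_mul_of_nonneg_right _ (by positivity); linarith
        _ = (MR + 2) * (2 * (n * τ)) := by ring
        _ ≤ N.toReal := hest
    have h3 : ENNReal.ofReal (4 * cutoffDerivBound * (Cu * δ' * T)) ≤ N := by
      rw [← hNeq]
      refine ENNReal.ofReal_le_ofReal ?_
      calc 4 * cutoffDerivBound * (Cu * δ' * T) = 4 * M * Cu * δ' * T := by rw [hM_def]; ring
        _ ≤ N.toReal := hδ'N
    calc _ ≤ N + ENNReal.ofReal (4 * cutoffDerivBound * C) * N + N := add_le_add (add_le_add h1 le_rfl) h3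
      _ = ENNReal.ofReal (4 * M * C + 2) * N := by
          rw [hM_def, ENNReal.ofReal_add (by positivity) zero_le_two, ENNReal.ofReal_ofNat]
          ring
  · -- (10) the velocity is unchanged off `I₀`
    intro t ht htI₀
    obtain ⟨i, hi, hti⟩ := exists_mem_Icc_node hT hn ht
    funext x
    rw [hglue.glueVel_apply hi hti x]
    by_cases hZi : Z i
    · rw [(hzero i hZi).1, smul_zero, add_zero]
    · exfalso
      simp only [Z, not_forall] at hZi
      obtain ⟨S, hS, x₀, hx₀⟩ := hZi
      refine htI₀ (hI₀_of_ne (hglue.Icc_subset hi hS) ⟨x₀, hx₀⟩ ?_)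
      rw [Real.dist_eq, abs_le]
      have := node_succ T n i
      constructor <;> linarith [hS.1, hS.2, hti.1, hti.2]

end Main

end Concentration

variable {d : Type*} [Fintype d] [DecidableEq d]

/-- **Cheskidov–Luo 2022, Prop. 3.1 from the corrector fact** — the named-fact-level statement:
`CheskidovLuo2022Corrector → CheskidovLuo2022Concentration` (see
`Concentration.concentration_of_corrector`). [cite: CheskidovLuo2022, Prop. 3.1] -/
theorem CheskidovLuo2022Concentration_of_corrector (hcorr : CheskidovLuo2022Corrector (d := d)) :
    CheskidovLuo2022Concentration (d := d) :=
  Concentration.concentration_of_corrector hcorr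

end Assembly

end Torus

end Literature.Analysis.FluidPDE
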